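import Mathlib
import HarnessLib
import Summits.NavierStokesRegularity.NavierStokesRegularity.Theorems.UnthreadedRigidityDoorUnthreadedRigidityMixedPairWindowBalance
import Summits.NavierStokesRegularity.NavierStokesRegularity.Theorems.UnthreadedRigidityDoorUnthreadedRigidityMixedPairSphereLaw
import Summits.NavierStokesRegularity.NavierStokesRegularity.Theorems.UnthreadedRigidityDoorUnthreadedRigidityMixedPairWindowReduction
import Summits.NavierStokesRegularity.NavierStokesRegularity.Theorems.UnthreadedRigidityDoorUnthreadedRigidityMixedPairQuadLawAlternative
import Summits.NavierStokesRegularity.NavierStokesRegularity.Theorems.UnthreadedRigidityDoorUnthreadedRigidityPersistenceCompositions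
import Summits.NavierStokesRegularity.NavierStokesRegularity.Theorems.UnthreadedRigidityDoorUnthreadedRigidityPersistenceWindowBalanceCounterexample

/-!
# Route `UnthreadedRigidityDoor`, item `UnthreadedRigidity` (W2, stmt-NavierStokesRegularity-27585) — LINE g11-2 «MIXED PAIR»:
# ★★ THE WINDOW RUNG `MixedPairWindowRigidity` HOLDS UNCONDITIONALLY — pair windows are EMPTY (persistence at first order)

Prover file (engine-1 g73; `--supports stmt-NavierStokesRegularity-27585 --as helper`; route-independent imports).

THE ARGUMENT (two shells meet LINE g12-2 «PERSISTENCE»; no second jet, no O2a′/O2b′/S-H′).  Let a bounded mild window (hypotheses of 27585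
verbatim; unthreadedness is not even used) have slices `u(t) = pairShell (H₁ t) (H₂ t) a Q x₀` — admissible dipole+quadrupole pairs over a FIXED
axis `a ≠ 0` and a FIXED traceless symmetric `Q` (ANY shape: coaxial, transverse, oblique, magic-angle …).  Then `u ≡ 0` on the window:
* `pair_window_toroidal_balance` (file `…MixedPairWindowBalance`): every slice is toroidally balanced over the pair with RADIAL coefficients;
* `pair_sphereLaw_b₂` (file `…MixedPairSphereLaw`): if `Q ≠ 0`, the quadrupole profile obeys the single-shell sphere law `b₂[H₂(t)] ≡ 0`;
* the profiles of a pair window are analytic on `(0,∞)` (`MixedPair.analyticOnNhd_pairProfile_right`, g72, from interior analyticity), so the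
  tree's `Persistence.cubicLaw` + `Persistence.cubicLawNonexistence` (es-p1 g8/g9) give `H₂(t) ≡ 0` on `(0,∞)`: the quadrupole shell is ABSENT;
* hence every slice is a single dipole shell over the nonzero harmonic `⟪a,·⟫`, and `Persistence.singleShellWindowVanishes 1` (es-p1 g9) gives
  `u ≡ 0`; if `Q = 0` the slices are dipole shells from the start.
A vanishing window is infinitesimally axisymmetric about every axis, so ★★ `mixedPairWindowRigidity_holds : MixedPairWindowRigidity` (the WINDOW
RUNG of LINE g11-2, stated for coaxial-or-transverse shapes) holds — in fact for all shapes (`pairWindow_vanishes`); and since the profiles of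
a vanishing pair are null (`pairWindow_dipoleProfile_null`, `pairWindow_quadProfile_null`, read-offs of g72), the window items O-W
`PairWindowReduction` and S-HW `HelmholtzWindowDead` of the line hold unconditionally too (`pairWindowReduction_holds`, `helmholtzWindowDead_holds`).  The slice rung
`MixedPairOrderTwoRigidity` (one instant, two jets) is NOT touched by this argument and still rests on the three slice laws.

HONEST LABEL: a RUNG about SPECIAL (hypothetical) two-shell windows is closed by showing the class is EMPTY; this is support for, not progress on,
`UnthreadedRigidity` (27585) itself, which stays OPEN together with the door Target, W2 and Navier–Stokes regularity; no summit statement is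
proved.  MODEL/rung work; 0 kit.
-/

noncomputable section

-- the summit and its single sub-problem share the name (CONVENTIONS §1), as in every Theorems file
set_option linter.dupNamespace false

namespace Summit.NavierStokesRegularity.NavierStokesRegularity.Theorems.UnthreadedRigidity.MixedPair

open Set Function Filter Topology
open scoped RealInnerProductSpace ContDiff
open Literature.Analysis Literature.Analysis.FluidPDE
open Literature.Analysis.UnboundedOperators (heatExtension)
open Summit.NavierStokesRegularity.NavierStokesRegularity.Theorems.UnthreadedRigidity.ProfileHorn (E3)
open Summit.NavierStokesRegularity.NavierStokesRegularity.Theorems.UnthreadedRigidity.VirialHorn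
  (e IsSolidHarmonic VirialAdmissible sepShellL vortAmpL window_analyticOnNhd_slice exists_skew_ne_zero)
open Summit.NavierStokesRegularity.NavierStokesRegularity.Theorems.UnthreadedRigidity.Persistence (cubicLaw cubicLawNonexistence
  sepShellL_null_of_pos singleShellWindowVanishes sepShellL_zero)

variable {S : Set ℝ} {u : ℝ → E3 → E3} {x₀ : E3}

/-- the quadrupole harmonic of `Q = 0` is the zero function. -/
theorem quadHarmonic_zero : quadHarmonic (0 : E3 →L[ℝ] E3) = fun _ => (0 : ℝ) := by
  funext y; simp [quadHarmonic]

/-- ★ **IN A PAIR WINDOW THE QUADRUPOLE PROFILE IS NULL** (`Q ≠ 0`): balance (bridge M for pairs) ⇒ pair sphere law `b₂ ≡ 0` ⇒ cubic law ⇒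
non-existence (profiles of window slices are analytic on `(0,∞)`). -/
theorem pairWindow_quadProfile_eq_zero (hS : IsOpen S) (hcont : ContinuousOn (uncurry u) (S ×ˢ univ))
    (hdiv : ∀ t ∈ S, VectorCalculus.IsDivFree (u t))
    (hmild : ∀ s ∈ S, ∀ t ∈ S, s < t → ∀ x, u t x = heatExtension (u s) (t - s) x - oseenDuhamel 1 s u u t x)
    (hbdd : ∀ τ ∈ S, ∃ B : ℝ, ∀ t ∈ S, t ≤ τ → ∀ x, ‖u t x‖ ≤ B)
    {a : E3} {Q : E3 →L[ℝ] E3} {H₁f H₂f : ℝ → ℝ → ℝ} (hQ0 : Q ≠ 0)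
    (hslice : ∀ t ∈ S, PairAdmissible (H₁f t) (H₂f t) a Q ∧ u t = pairShell (H₁f t) (H₂f t) a Q x₀) {t : ℝ} (ht : t ∈ S) :
    ∀ r : ℝ, 0 < r → H₂f t r = 0 := by
  obtain ⟨hadm, hu⟩ := hslice t ht
  have han : AnalyticOnNhd ℝ (H₂f t) (Ioi 0) := by
    have hsl : AnalyticOnNhd ℝ (pairShell (H₁f t) (H₂f t) a Q x₀) univ := by
      rw [← hu]; exact window_analyticOnNhd_slice hS hcont hmild hbdd ht
    exact analyticOnNhd_pairProfile_right hadm hQ0 x₀ hsl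
  have hbal := pair_window_toroidal_balance hS hcont hdiv hmild hbdd hslice ht
  rw [hu] at hbal
  have hb₂ := pair_sphereLaw_b₂ hadm hQ0 x₀ hbal
  exact cubicLawNonexistence (H₂f t) hadm.2.2.2 han (cubicLaw (H₂f t) hadm.2.2.2 han hb₂)

/-- ★★ **PAIR WINDOWS VANISH** (every shape `Q`, every axis `a ≠ 0`): the quadrupole shell is absent (`Q = 0`, or `H₂ ≡ 0` by the previous
theorem), so the slices are single dipole shells over the nonzero harmonic `⟪a,·⟫`, and single-shell windows vanish
(`Persistence.singleShellWindowVanishes 1`). -/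
theorem pairWindow_vanishes (hS : IsOpen S) (hcont : ContinuousOn (uncurry u) (S ×ˢ univ))
    (hdiv : ∀ t ∈ S, VectorCalculus.IsDivFree (u t))
    (hmild : ∀ s ∈ S, ∀ t ∈ S, s < t → ∀ x, u t x = heatExtension (u s) (t - s) x - oseenDuhamel 1 s u u t x)
    (hbdd : ∀ τ ∈ S, ∃ B : ℝ, ∀ t ∈ S, t ≤ τ → ∀ x, ‖u t x‖ ≤ B)
    {a : E3} {Q : E3 →L[ℝ] E3} {H₁f H₂f : ℝ → ℝ → ℝ}
    (hslice : ∀ t ∈ S, PairAdmissible (H₁f t) (H₂f t) a Q ∧ u t = pairShell (H₁f t) (H₂f t) a Q x₀) :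
    ∀ t ∈ S, ∀ x, u t x = 0 := by
  -- the slices are single dipole shells
  have hshape : ∀ t ∈ S, u t = sepShellL (H₁f t) (dipoleHarmonic a) x₀ := by
    intro t ht
    obtain ⟨hadm, hu⟩ := hslice t ht
    rw [hu]
    funext x
    show sepShellL (H₁f t) (dipoleHarmonic a) x₀ x + sepShellL (H₂f t) (quadHarmonic Q) x₀ x = _
    by_cases hQ0 : Q = 0
    · rw [hQ0, quadHarmonic_zero, sepShellL_zero, add_zero]
    · rw [sepShellL_null_of_pos (H₂f t) (quadHarmonic Q) x₀
        (pairWindow_quadProfile_eq_zero hS hcont hdiv hmild hbdd hQ0 hslice ht) x, add_zero]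
  -- a nonzero axis gives a nonzero dipole harmonic
  obtain ⟨t₀, ht₀⟩ | hempty := S.eq_empty_or_nonempty.symm
  · have ha : a ≠ 0 := (hslice t₀ ht₀).1.1
    have hYne : ∃ y, dipoleHarmonic a y ≠ 0 :=
      ⟨a, by simpa [dipoleHarmonic, real_inner_self_eq_norm_sq] using ha⟩
    exact singleShellWindowVanishes 1 le_rfl S hS u x₀ hcont hdiv hmild hbdd (dipoleHarmonic a) H₁f (isSolidHarmonic_dipoleHarmonic a)
      hYne (fun t ht => (hslice t ht).1.2.2.1) hshape
  · intro t ht; rw [hempty] at ht; exact absurd ht (Set.notMem_empty t)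

/-- in a pair window the DIPOLE profile is null too (read-off of the vanishing slice along the axis). -/
theorem pairWindow_dipoleProfile_null (hS : IsOpen S) (hcont : ContinuousOn (uncurry u) (S ×ˢ univ))
    (hdiv : ∀ t ∈ S, VectorCalculus.IsDivFree (u t))
    (hmild : ∀ s ∈ S, ∀ t ∈ S, s < t → ∀ x, u t x = heatExtension (u s) (t - s) x - oseenDuhamel 1 s u u t x)
    (hbdd : ∀ τ ∈ S, ∃ B : ℝ, ∀ t ∈ S, t ≤ τ → ∀ x, ‖u t x‖ ≤ B)
    {a : E3} {Q : E3 →L[ℝ] E3} {H₁f H₂f : ℝ → ℝ → ℝ}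
    (hslice : ∀ t ∈ S, PairAdmissible (H₁f t) (H₂f t) a Q ∧ u t = pairShell (H₁f t) (H₂f t) a Q x₀) {t : ℝ} (ht : t ∈ S) :
    IsNullProfile (H₁f t) := by
  obtain ⟨hadm, hu⟩ := hslice t ht
  have hzero := pairWindow_vanishes hS hcont hdiv hmild hbdd hslice t ht
  have ha : a ≠ 0 := hadm.1
  have han : ‖a‖ ≠ 0 := norm_ne_zero_iff.2 ha
  set e : E3 := (‖a‖⁻¹ : ℝ) • a with he_def
  have he : ‖e‖ = 1 := by rw [he_def, norm_smul, norm_inv, norm_norm, inv_mul_cancel₀ han]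
  have hae : ⟪a, e⟫ = ‖a‖ := by
    rw [he_def, real_inner_smul_right, real_inner_self_eq_norm_sq]
    field_simp
  refine isNullProfile_of_forall_pos hadm.2.2.1 fun r hr => ?_
  have h := pair_readOff_odd hadm x₀ he hr
  rw [← hu, hzero, hzero, inner_zero_left, inner_zero_left, sub_zero, hae] at h
  have h4 : (4 * r * ‖a‖) * H₁f t r = 0 := by rw [← h]
  rcases mul_eq_zero.1 h4 with h1 | h1
  · exfalso
    have : 0 < 4 * r * ‖a‖ := by positivity
    exact this.ne' h1
  · exact h1

/-- in a pair window with `Q ≠ 0` the QUADRUPOLE profile is null (on `[0,∞)`). -/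
theorem pairWindow_quadProfile_null (hS : IsOpen S) (hcont : ContinuousOn (uncurry u) (S ×ˢ univ))
    (hdiv : ∀ t ∈ S, VectorCalculus.IsDivFree (u t))
    (hmild : ∀ s ∈ S, ∀ t ∈ S, s < t → ∀ x, u t x = heatExtension (u s) (t - s) x - oseenDuhamel 1 s u u t x)
    (hbdd : ∀ τ ∈ S, ∃ B : ℝ, ∀ t ∈ S, t ≤ τ → ∀ x, ‖u t x‖ ≤ B)
    {a : E3} {Q : E3 →L[ℝ] E3} {H₁f H₂f : ℝ → ℝ → ℝ} (hQ0 : Q ≠ 0)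
    (hslice : ∀ t ∈ S, PairAdmissible (H₁f t) (H₂f t) a Q ∧ u t = pairShell (H₁f t) (H₂f t) a Q x₀) {t : ℝ} (ht : t ∈ S) :
    IsNullProfile (H₂f t) :=
  isNullProfile_of_forall_pos (hslice t ht).1.2.2.2 (pairWindow_quadProfile_eq_zero hS hcont hdiv hmild hbdd hQ0 hslice ht)

/-- ★ O-W «PAIR WINDOW REDUCTION» HOLDS UNCONDITIONALLY (the dipole profile of every slice is null). -/
theorem pairWindowReduction_holds : MixedPair.PairWindowReduction := by
  intro S hS u x₀ hcont hdiv hmild hbdd _ a Q H₁f H₂f _ _ hslice t ht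
  exact Or.inl (pairWindow_dipoleProfile_null hS hcont hdiv hmild hbdd hslice ht)

/-- ★ S-HW «HELMHOLTZ SLICES DO NOT OCCUR IN A SILENT WINDOW» HOLDS UNCONDITIONALLY (same reason). -/
theorem helmholtzWindowDead_holds : MixedPair.HelmholtzWindowDead := by
  intro S hS u x₀ hcont hdiv hmild hbdd _ a Q H₁f H₂f _ hslice t ht _
  exact Or.inl (pairWindow_dipoleProfile_null hS hcont hdiv hmild hbdd hslice ht)

/-- ★★ **THE WINDOW RUNG OF LINE g11-2 HOLDS, UNCONDITIONALLY: `MixedPairWindowRigidity`** (the crux 27585 restricted to windows whose slices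
are admissible dipole+quadrupole pairs over a fixed axis and a fixed coaxial-or-transverse shape).  The window vanishes (`pairWindow_vanishes`,
any shape), and the zero window is infinitesimally axisymmetric (any nonzero skew map, `VirialHorn.exists_skew_ne_zero`). -/
theorem mixedPairWindowRigidity_holds : MixedPair.MixedPairWindowRigidity := by
  intro S hS _ u x₀ hcont hdiv hmild hbdd _ hpair
  obtain ⟨a, Q, H₁f, H₂f, _, hslice⟩ := hpair
  have hzero := pairWindow_vanishes hS hcont hdiv hmild hbdd hslice
  obtain ⟨A, hskew, hA0⟩ := exists_skew_ne_zero
  refine ⟨A, hskew, hA0, fun t ht x => ?_⟩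
  have hut : u t = fun _ => (0 : E3) := funext (hzero t ht)
  rw [hut]
  simp

end Summit.NavierStokesRegularity.NavierStokesRegularity.Theorems.UnthreadedRigidity.MixedPair

end
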